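import Literature.NumberTheory.ComplexMultiplication.EllipticUnits.ImaginaryQuadraticMainConjectureCarriers
import Literature.NumberTheory.GaloisRepresentations.RelativeCorestrictionConj
import Literature.NumberTheory.GaloisRepresentations.ConjugationDescent
import Literature.NumberTheory.GaloisRepresentations.ContinuousCohomologyTorsion
import Literature.NumberTheory.GaloisRepresentations.ContinuousCohomologyZeroIsoNaturality
import Literature.NumberTheory.EllipticCurves.IwasawaTowerLayers
import Literature.GroupTheory.ProfiniteSubquotients
import HarnessLib

/-!
# Toward the EXISTENCE of the pinned carriers `H^i(𝒪_K[1/p𝔣], Λ(χ)(1)) = lim←_{n,k} H^i(G_S(K̃_n), μ_{p^k} ⊗ θ)`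
# (`i = 0, 1, 2`) of Johnson-Leung–Kings 2011 Def. 4.2 (94) / Cor. 5.3 with their
# `Λ = ℤ_p⟦Gal(K_∞/K)⟧`-structure: `Nonempty (JohnsonLeungKings2011.IwasawaCohomologyData p κ₁ κ₂ γ₁ γ₂ θ 𝔣 i)`
# — part I: the LEVEL structure (uniform torsion, the two conjugation operators, `IsLocNil₂`, equivariance of the transitions)

Topic `Literature/NumberTheory/ComplexMultiplication/EllipticUnits` (grouping sub-namespace
`JohnsonLeungKings2011`); companion of `ImaginaryQuadraticMainConjectureCarriers.lean` (ty2 g37, cell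
`bsd-print-cf2`), whose module docstring §5 names this construction ("booking (M1)": the cell's kernel
construction of the pinned data; planner item F0a). Width seat `bsd-line-cf2-p1-w5` g9. THEOREMS and
transparent definitions only; no named fact, no `instance`, no `sorry`.

THE CONSTRUCTION (Kato §8.2 "`H^q(R,T) = lim←_n H^q(R, T/p^n)`"; JLK Def. 4.2 (94)
"`H^i(𝒪_K[1/p], Λ(η)) = lim←_{K ⊂ K_n ⊂ K_∞} H^i(𝒪_{K_n}[1/p], 𝒪_p(η))`" with "the (left) `Λ_𝒪`-module structure";
Lang, *Cyclotomic Fields* Ch. 5 §1 "`Λ = lim 𝔬[X]/((1+X)^{pⁿ} − 1)`"): `H := ` the compatible families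
`(y_{n,k})` in `∏_{n,k} H^i(G_S(K̃_n), μ_{p^k} ⊗ θ)` (compatible with the corestrictions `layerCores` in `n`
and the reductions `layerRed` in `k`), a `Λ₂ = ℤ_p⟦T₂⟧⟦T₁⟧`-submodule of the product for the LEVELWISE
structures `T_i ↦ conj_{γ_i} − 1` (the tree's `IwasawaDual.IsLocNil₂.selfModule`): on the level `(n, k)`
the operators `conj_{γ₁}, conj_{γ₂}` (ty2's `layerConj`, the tree's `conjMap`) COMMUTE (their commutator
is conjugation by `[γ₁, γ₂] ∈ Gal(K̄/K̃_∞) ≤ Gal(K̄/K̃_n)`, an inner automorphism of the level group), are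
UNIPOTENT of echelon `pⁿ` (`γ^{pⁿ} ∈ Gal(K̄/K̃_n)` for EVERY `γ ∈ Γ_K` since `κ_i(γ^{pⁿ}) = pⁿκ_i(γ)`;
inner automorphisms act trivially on `H^i`, degrees `0, 1, 2`) and the level is killed by `p^k`
UNIFORMLY (its coefficients are); so `(conj_{γ₁} − 1, conj_{γ₂} − 1)` is `IsLocNil₂` and the level is a
`Λ₂`-module through a finite quotient ring (`isLocNil₂_twistEnd_sub_one`). The transition maps are
`Λ₂`-linear because they intertwine the conjugations: for the corestrictions this is the tree's
`relCor_conjMap` (`RelativeCorestrictionConj.lean`: ty2's `relCores` IS `cor ∘ toSubgroupOf`), for the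
reductions the tree's `cohomologyMap_conjMap`. The pins (P1)–(P8) are then definitional unfoldings
(`IsLocNil₂.X_smul`, `C_X_smul`, `C_C_smul`). NO hypothesis on `K`, `(γ₁, γ₂)`, `θ`, `𝔣` is used.

* §0 two generic supplements: `conjMap_eq_self_of_mem_zero` (inner automorphisms act trivially on `H⁰`,
  the degree-`0` sibling of the tree's `conjMap_eq_self_of_mem_one/_two`, via `zeroIso_hom_map_apply`) and
  `IwasawaDual.twistEnd_one`.
* §1 the level structure: normality of the image groups, UNIFORM `p^k`-torsion of `levelCoh`
  (`levelCoh_torsion`), powers / triviality / commutation of `layerConj`, `isLocNil₂_layerConj`.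
* §2 equivariance of `layerCores` / `layerRed`.
* (part II, `ImaginaryQuadraticMainConjectureCarriersExist.lean`) the `Λ₂`-submodule `compatibleFamilies`,
  `iwasawaCohomologyData`, `nonempty_iwasawaCohomologyData`, `iwasawaCohomologyDataExists`.

## References
* [JohnsonLeungKings2011] J. reine angew. Math. 653 (2011) = arXiv:0804.2828, §4.2 Def. 4.2 (94) and the
  sentence on the `Λ_𝒪`-module structure (p0012:L80–112); Cor. 5.3 (p0015:L1–20).
* [Kato2004Asterisque] K. Kato, Astérisque 295 (2004), §8.2 (p. 180), §12.2 (12.2.1) (p. 220).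
* [Lang1990] S. Lang, *Cyclotomic Fields I and II*, Ch. 5 §1 (Thm. 1.1).
* [SerreLocalFields1979] VII §5 Prop. 3 (inner automorphisms act trivially); [NeukirchSchmidtWingberg2008] I §5 Prop. 1.5.4.
-/

noncomputable section

open scoped NumberField
open CategoryTheory Field IsDedekindDomain
open Literature.NumberTheory.GaloisRepresentations
open Literature.NumberTheory.GaloisRepresentations.DiscreteGaloisModule
open Literature.NumberTheory.EllipticCurves Literature.NumberTheory.EllipticCurves.IwasawaDual

/-! ## §0 Two generic supplements -/

namespace Literature.NumberTheory.GaloisRepresentations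

universe u v

section Zero

variable {R : Type u} [CommRing R] [TopologicalSpace R]
variable {G : Type v} [Group G] [TopologicalSpace G] [IsTopologicalGroup G]
variable (X : TopRep.{v} R G) (N : Subgroup G) [N.Normal]

/-- **Elements of `N` act trivially on `H⁰(N, X)`** (degree-`0` sibling of the tree's
`conjMap_eq_self_of_mem_one/_two`): under `H⁰ ≅ X^N` the map of the pair `(x ↦ n⁻¹xn, v ↦ n·v)` is
`v ↦ n·v` on invariants (`ZeroIsoNaturality.zeroIso_hom_map_apply`), the identity for `n ∈ N`.
[cite: SerreLocalFields1979, VII §5 Prop. 3] -/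
theorem conjMap_eq_self_of_mem_zero {n : G} (hn : n ∈ N) (y : continuousCohomology 0 (subgroupRep X N)) :
    conjMap X N n 0 y = y := by
  have hinj : Function.Injective (ContinuousCohomology.zeroIso (subgroupRep X N)).hom := by
    intro a b h
    have h2 := congrArg (ContinuousCohomology.zeroIso (subgroupRep X N)).inv h
    simp only [Iso.hom_inv_id_apply] at h2
    exact h2
  apply hinj
  apply Subtype.ext
  rw [conjMap, ZeroIsoNaturality.zeroIso_hom_map_apply]
  change X.ρ n _ = _
  have hv := (ContRepresentation.mem_invariants _).mp
    ((ContinuousCohomology.zeroIso (subgroupRep X N)).hom y).2 ⟨n, hn⟩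
  exact hv

end Zero

end Literature.NumberTheory.GaloisRepresentations

namespace Literature.NumberTheory.EllipticCurves.IwasawaDual

/-- The untwisted operator: `twistEnd 1 γ = γ`. [cite: Lang1990, Ch. 5 §1] -/
theorem twistEnd_one {L : Type*} [AddCommGroup L] (γ : AddMonoid.End L) : twistEnd 1 γ = γ := by
  ext a
  rw [twistEnd_apply, one_smul]

end Literature.NumberTheory.EllipticCurves.IwasawaDual

namespace Literature.NumberTheory.ComplexMultiplication.EllipticUnits.JohnsonLeungKings2011

/-! ## §1 The level structure: uniform torsion, the conjugation operators, `IsLocNil₂` -/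

section Level

variable {K : Type} [Field K] [NumberField K] (p : ℕ) [Fact p.Prime]
  (S : Set (HeightOneSpectrum (𝓞 K))) (θ : absoluteGaloisGroup K →ₜ* ℤ_[p]ˣ)

omit [NumberField K] in
/-- The image in `G_S` of a normal subgroup of `Γ_K` is normal (`Γ_K ↠ G_S` onto) — public twin of the
companion file's private lemma. [cite: JohnsonLeungKings2011, §2.1 (arXiv p0006:L10–12)] -/
theorem normal_imGS (U : Subgroup (absoluteGaloisGroup K)) [U.Normal] : (imGS S U).Normal := by
  unfold imGS
  exact Subgroup.Normal.map inferInstance _ (toUnramifiedQuot_surjective K S)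

omit [NumberField K] in
/-- The image in `G_S` of an open subgroup of `Γ_K` is closed. [cite: JohnsonLeungKings2011, §2.1 (arXiv p0006:L10–12)] -/
theorem isClosed_imGS' {U : Subgroup (absoluteGaloisGroup K)} (hU : IsOpen (U : Set (absoluteGaloisGroup K))) :
    IsClosed (imGS S U : Set (GaloisGroupUnramifiedOutside K S)) :=
  Subgroup.isClosed_of_isOpen _ (isOpenMap_toUnramifiedQuot K S _ hU)

omit [NumberField K] in
/-- The image in `G_S` of an open subgroup of `Γ_K` has finite index.
[cite: JohnsonLeungKings2011, §2.1 (arXiv p0006:L10–12)] -/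
theorem finiteIndex_imGS' [CompactSpace (absoluteGaloisGroup K)] {U : Subgroup (absoluteGaloisGroup K)}
    (hU : IsOpen (U : Set (absoluteGaloisGroup K))) : (imGS S U).FiniteIndex := by
  haveI : DiscreteTopology (GaloisGroupUnramifiedOutside K S ⧸ imGS S U) :=
    QuotientGroup.discreteTopology (isOpenMap_toUnramifiedQuot K S _ hU)
  haveI : Finite (GaloisGroupUnramifiedOutside K S ⧸ imGS S U) := finite_of_compact_of_discrete
  exact Subgroup.finiteIndex_of_finite_quotient

omit [NumberField K] in
/-- **The coefficients `(μ_{p^k} ⊗ θ)^{N_S}` are killed by `p^k`** (`ζ^{p^k} = 1`).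
[cite: JohnsonLeungKings2011, Def. 1.1 and Def. 4.2 (arXiv p0005:L1–12, p0012:L80–95)] -/
theorem coeffGS_torsion (k : ℕ) (w : (coeffGS p S θ k).toTopRep) : (p ^ k : ℤ) • w = 0 := by
  apply Subtype.ext
  apply muVal_injective K (p ^ k)
  rw [Submodule.coe_smul, Submodule.coe_zero, muVal_zero, ← Nat.cast_pow, natCast_zsmul, muVal_nsmul,
    muVal_pow_eq_one]

/-- **UNIFORM `p^k`-torsion of the level groups**: every class of `H^i(G_S(F), μ_{p^k} ⊗ θ)` is killed by
`p^k` (a class is represented by a cochain with values in the `p^k`-torsion coefficients; the tree's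
`continuousCohomology_exists_forall_smul_eq_zero` with the constant family `J ≡ (p^k)`).
[cite: Kato2004Asterisque, §8.2 (p. 180)] [cite: Lang1990, Ch. 5 §1] -/
theorem levelCoh_torsion {U : Subgroup (absoluteGaloisGroup K)} (hU : IsOpen (U : Set (absoluteGaloisGroup K)))
    (k i : ℕ) (x : levelCoh p S θ U k i) : p ^ k • x = 0 := by
  haveI : CompactSpace (imGS S U) := isCompact_iff_compactSpace.mp (isClosed_imGS' S hU).isCompact
  obtain ⟨m, hm⟩ := continuousCohomology_exists_forall_smul_eq_zero (levelRep p S θ U k).toTopRep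
    (fun _ ↦ Ideal.span {((p ^ k : ℕ) : ℤ)})
    (fun C _ ↦ ⟨0, fun r hr w _ ↦ by
      obtain ⟨c, rfl⟩ := Ideal.mem_span_singleton'.mp hr
      rw [mul_comm, mul_smul, Nat.cast_pow, coeffGS_torsion]⟩) i x
  have h := hm ((p ^ k : ℕ) : ℤ) (Ideal.mem_span_singleton_self _)
  rwa [Nat.cast_smul_eq_nsmul] at h

variable {U : Subgroup (absoluteGaloisGroup K)} [U.Normal]

/-- The conjugation operator of `γ` on a level group, as an element of `AddMonoid.End` (for powers and
`IsLocNil₂`). [cite: JohnsonLeungKings2011, §4.2 (arXiv p0012:L109–112)] -/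
abbrev conjEnd (U : Subgroup (absoluteGaloisGroup K)) [U.Normal] (k i : ℕ) (γ : absoluteGaloisGroup K) :
    AddMonoid.End (levelCoh p S θ U k i) :=
  levelConj p S θ U k i γ

omit [NumberField K] in
/-- Unfolding `conjEnd`. [cite: JohnsonLeungKings2011, §4.2 (arXiv p0012:L109–112)] -/
theorem conjEnd_apply (k i : ℕ) (γ : absoluteGaloisGroup K) (c : levelCoh p S θ U k i) :
    conjEnd p S θ U k i γ c = levelConj p S θ U k i γ c := rfl

omit [NumberField K] in
/-- **`1 ∈ Γ_K` acts trivially** on the levels (`map (id, id) = id`). [cite: SerreLocalFields1979, VII §5] -/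
theorem levelConj_one (k i : ℕ) (c : levelCoh p S θ U k i) : levelConj p S θ U k i 1 c = c := by
  haveI := normal_imGS S U
  rw [levelConj_apply]
  have h : conjMap (coeffGS p S θ k).toTopRep (imGS S U) (toUnramifiedQuot K S 1) i = 𝟙 _ := by
    rw [map_one, conjMap]
    exact continuousCohomology_map_eq_id _ _ (subgroupConj_one _)
      (fun v ↦ by
        change (coeffGS p S θ k).toTopRep.ρ 1 v = v
        rw [map_one]; rfl) i
  rw [h]; rfl

omit [NumberField K] in
/-- **`(γ ·) ∘ (γ' ·) = (γγ' ·)`** on the levels (`conjMap_conjMap`). [cite: SerreLocalFields1979, VII §5] -/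
theorem levelConj_levelConj (k i : ℕ) (γ γ' : absoluteGaloisGroup K) (c : levelCoh p S θ U k i) :
    levelConj p S θ U k i γ (levelConj p S θ U k i γ' c) = levelConj p S θ U k i (γ * γ') c := by
  haveI := normal_imGS S U
  rw [levelConj_apply, levelConj_apply, levelConj_apply, conjMap_conjMap, ← map_mul]

omit [NumberField K] in
/-- **Powers of the conjugation operator**: `(γ ·)^m = (γ^m ·)`. [cite: SerreLocalFields1979, VII §5] -/
theorem conjEnd_pow_apply (k i : ℕ) (γ : absoluteGaloisGroup K) (m : ℕ) (c : levelCoh p S θ U k i) :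
    (conjEnd p S θ U k i γ ^ m) c = levelConj p S θ U k i (γ ^ m) c := by
  induction m generalizing c with
  | zero => rw [pow_zero, pow_zero, AddMonoid.End.one_apply, levelConj_one]
  | succ m ih =>
    rw [pow_succ, AddMonoid.End.coe_mul, Function.comp_apply, conjEnd_apply, ih, levelConj_levelConj,
      ← pow_succ]

/-- **Elements of `U` act trivially on `H^i(G_S(F), ·)`, `i = 0, 1, 2`** (inner automorphisms of the level
group; the tree's `conjMap_eq_self_of_mem_one/_two` and §0). [cite: SerreLocalFields1979, VII §5 Prop. 3] -/
theorem levelConj_eq_self_of_mem {γ : absoluteGaloisGroup K} (hγ : γ ∈ U)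
    (hU : IsOpen (U : Set (absoluteGaloisGroup K))) (k : ℕ) {i : ℕ} (hi : i ≤ 2)
    (c : levelCoh p S θ U k i) : levelConj p S θ U k i γ c = c := by
  haveI := normal_imGS S U
  haveI : LocallyCompactSpace (imGS S U) := (isClosed_imGS' S hU).locallyCompactSpace
  have hmem : toUnramifiedQuot K S γ ∈ imGS S U := Subgroup.mem_map_of_mem _ hγ
  rw [levelConj_apply]
  obtain rfl | rfl | rfl : i = 0 ∨ i = 1 ∨ i = 2 := by omega
  · exact conjMap_eq_self_of_mem_zero (coeffGS p S θ k).toTopRep (imGS S U) hmem c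
  · exact conjMap_eq_self_of_mem_one (coeffGS p S θ k).toTopRep (imGS S U) hmem c
  · exact conjMap_eq_self_of_mem_two (coeffGS p S θ k).toTopRep (imGS S U) hmem c

end Level

/-! ### The layers of the `ℤ_p²`-tower: every `γ^{pⁿ}` lies in `Gal(K̄/K̃_n)`, commutators lie in `Gal(K̄/K̃_∞)` -/

section Layers

variable {K : Type} [Field K] {p : ℕ} [Fact p.Prime] (κ₁ κ₂ : ZpExtension K p)

/-- **`γ^{pⁿ} ∈ Gal(K̄/K̃_n)` for EVERY `γ ∈ Γ_K`** (`κ_i(γ^{pⁿ}) = pⁿ·κ_i(γ)`).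
[cite: JohnsonLeungKings2011, §4.1 (arXiv p0012:L7–14)] -/
theorem pow_mem_pairLayerSubgroup (γ : absoluteGaloisGroup K) (n : ℕ) :
    γ ^ p ^ n ∈ pairLayerSubgroup κ₁ κ₂ n := by
  refine Subgroup.mem_inf.mpr ⟨?_, ?_⟩ <;>
  · rw [ZpExtension.mem_layerSubgroup, map_pow, toAdd_pow, nsmul_eq_mul, Nat.cast_pow]
    exact Dvd.intro _ rfl

/-- **Commutators of `Γ_K` lie in `Gal(K̄/K̃_∞) ≤ Gal(K̄/K̃_n)`** (`κ_i` is a homomorphism to an abelian group).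
[cite: JohnsonLeungKings2011, §4.1 (arXiv p0012:L7–14)] -/
theorem commutator_mem_pairLayerSubgroup (σ τ : absoluteGaloisGroup K) (n : ℕ) :
    σ * τ * σ⁻¹ * τ⁻¹ ∈ pairLayerSubgroup κ₁ κ₂ n := by
  refine pairKer_le_pairLayerSubgroup κ₁ κ₂ n (ZpExtension.mem_pairKer_iff.mpr ⟨?_, ?_⟩) <;>
  · simp only [map_mul, map_inv, mul_inv_cancel_comm, mul_inv_cancel]

end Layers

/-! ### `IsLocNil₂` of the two conjugation operators on the layer groups; equivariance of the transitions -/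

section LayerOps

variable {K : Type} [Field K] [NumberField K] (p : ℕ) [Fact p.Prime]
  (κ₁ κ₂ : ZpExtension K p) (γ₁ γ₂ : absoluteGaloisGroup K)
  (θ : absoluteGaloisGroup K →ₜ* ℤ_[p]ˣ) (𝔣 : Ideal (𝓞 K))

/-- The conjugation operator of `γ` on the layer group `(n, k)`, in `AddMonoid.End`. [cite: JohnsonLeungKings2011, §4.2 (arXiv p0012:L109–112)] -/
abbrev layerConjEnd (n k i : ℕ) (γ : absoluteGaloisGroup K) : AddMonoid.End (layerCoh p κ₁ κ₂ θ 𝔣 n k i) :=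
  conjEnd p (suppPF p 𝔣) θ (pairLayerSubgroup κ₁ κ₂ n) k i γ

/-- **`(γ ·)^{pⁿ} = id` on the layer `(n, k)`**, `i ≤ 2` (`γ^{pⁿ} ∈ Gal(K̄/K̃_n)` acts as an inner automorphism).
[cite: Lang1990, Ch. 5 §1] [cite: SerreLocalFields1979, VII §5 Prop. 3] -/
theorem layerConjEnd_pow_apply_eq_self (n k : ℕ) {i : ℕ} (hi : i ≤ 2) (γ : absoluteGaloisGroup K)
    (c : layerCoh p κ₁ κ₂ θ 𝔣 n k i) : (layerConjEnd p κ₁ κ₂ θ 𝔣 n k i γ ^ p ^ n) c = c := by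
  rw [layerConjEnd, conjEnd_pow_apply]
  exact levelConj_eq_self_of_mem p (suppPF p 𝔣) θ (pow_mem_pairLayerSubgroup κ₁ κ₂ γ n)
    (isOpen_pairLayerSubgroup κ₁ κ₂ n) k hi c

/-- **The two conjugation operators commute on the layers**, `i ≤ 2`: `(γ₁ ·)(γ₂ ·) = ([γ₁,γ₂] ·)(γ₂ ·)(γ₁ ·)` and
the commutator lies in `Gal(K̄/K̃_n)`. [cite: JohnsonLeungKings2011, §4.1–4.2 (arXiv p0012:L7–14, L109–112)] -/
theorem commute_layerConjEnd (n k : ℕ) {i : ℕ} (hi : i ≤ 2) :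
    Commute (layerConjEnd p κ₁ κ₂ θ 𝔣 n k i γ₁) (layerConjEnd p κ₁ κ₂ θ 𝔣 n k i γ₂) := by
  ext c
  change levelConj p (suppPF p 𝔣) θ _ k i γ₁ (levelConj p (suppPF p 𝔣) θ _ k i γ₂ c) =
    levelConj p (suppPF p 𝔣) θ _ k i γ₂ (levelConj p (suppPF p 𝔣) θ _ k i γ₁ c)
  rw [levelConj_levelConj, levelConj_levelConj,
    show γ₁ * γ₂ = (γ₁ * γ₂ * γ₁⁻¹ * γ₂⁻¹) * (γ₂ * γ₁) by group, ← levelConj_levelConj,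
    levelConj_eq_self_of_mem p (suppPF p 𝔣) θ (commutator_mem_pairLayerSubgroup κ₁ κ₂ γ₁ γ₂ n)
      (isOpen_pairLayerSubgroup κ₁ κ₂ n) k hi]

/-- **`(conj_{γ₁} − 1, conj_{γ₂} − 1)` is `IsLocNil₂` on every layer group `H^i(G_S(K̃_n), μ_{p^k} ⊗ θ)`, `i ≤ 2`**
— so the layer is a `Λ₂ = ℤ_p⟦T₂⟧⟦T₁⟧`-module with `T_i ↦ conj_{γ_i} − 1` (`IsLocNil₂.selfModule`), through the finite
quotient `Λ₂/((1+T₁)^{pⁿ} − 1, (1+T₂)^{pⁿ} − 1, p^k)`. [cite: JohnsonLeungKings2011, §4.2 (arXiv p0012:L109–112)] [cite: Lang1990, Ch. 5 §1] -/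
theorem isLocNil₂_layerConjEnd (n k : ℕ) {i : ℕ} (hi : i ≤ 2) :
    IsLocNil₂ p (layerConjEnd p κ₁ κ₂ θ 𝔣 n k i γ₁ - 1) (layerConjEnd p κ₁ κ₂ θ 𝔣 n k i γ₂ - 1) := by
  have h := isLocNil₂_twistEnd_sub_one (p := p) (e := k) (m₁ := n) (m₂ := n) (n₁ := 1) (n₂ := 1)
    (layerConjEnd p κ₁ κ₂ θ 𝔣 n k i γ₁) (layerConjEnd p κ₁ κ₂ θ 𝔣 n k i γ₂)
    (commute_layerConjEnd p κ₁ κ₂ γ₁ γ₂ θ 𝔣 n k hi)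
    (fun a ↦ levelCoh_torsion p (suppPF p 𝔣) θ (isOpen_pairLayerSubgroup κ₁ κ₂ n) k i a)
    (fun a ↦ layerConjEnd_pow_apply_eq_self p κ₁ κ₂ θ 𝔣 n k hi γ₁ a)
    (fun a ↦ layerConjEnd_pow_apply_eq_self p κ₁ κ₂ θ 𝔣 n k hi γ₂ a)
    (by rw [Nat.cast_one, sub_self]; exact dvd_zero _) (by rw [Nat.cast_one, sub_self]; exact dvd_zero _)
  rwa [twistEnd_one, twistEnd_one] at h

/-- **The corestrictions intertwine the conjugation operators**: `cor_{K̃_{n+1}/K̃_n} ∘ (γ ·) = (γ ·) ∘ cor`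
(the tree's `relCor_conjMap`: ty2's `relCores` is `cor ∘ toSubgroupOf`). [cite: NeukirchSchmidtWingberg2008, I §5 Prop. 1.5.4] -/
theorem layerCores_layerConj (n k i : ℕ) (γ : absoluteGaloisGroup K) (y : layerCoh p κ₁ κ₂ θ 𝔣 (n + 1) k i) :
    layerCores p κ₁ κ₂ θ 𝔣 n k i (layerConj p κ₁ κ₂ θ 𝔣 (n + 1) k i γ y) =
      layerConj p κ₁ κ₂ θ 𝔣 n k i γ (layerCores p κ₁ κ₂ θ 𝔣 n k i y) := by
  haveI : TotallyDisconnectedSpace (GaloisGroupUnramifiedOutside K (suppPF p 𝔣)) :=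
    Literature.GroupTheory.ProfiniteSubquotients.totallyDisconnectedSpace_quotient
      (ramificationSubgroup K (suppPF p 𝔣)) (ramificationSubgroup_isClosed K _)
  haveI := normal_imGS (suppPF p 𝔣) (pairLayerSubgroup κ₁ κ₂ n)
  haveI := normal_imGS (suppPF p 𝔣) (pairLayerSubgroup κ₁ κ₂ (n + 1))
  haveI : IsClosed (imGS (suppPF p 𝔣) (pairLayerSubgroup κ₁ κ₂ n) : Set (GaloisGroupUnramifiedOutside K (suppPF p 𝔣))) :=
    isClosed_imGS' _ (isOpen_pairLayerSubgroup κ₁ κ₂ n)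
  haveI : IsClosed (imGS (suppPF p 𝔣) (pairLayerSubgroup κ₁ κ₂ (n + 1)) : Set (GaloisGroupUnramifiedOutside K (suppPF p 𝔣))) :=
    isClosed_imGS' _ (isOpen_pairLayerSubgroup κ₁ κ₂ (n + 1))
  haveI : ((imGS (suppPF p 𝔣) (pairLayerSubgroup κ₁ κ₂ (n + 1))).subgroupOf
      (imGS (suppPF p 𝔣) (pairLayerSubgroup κ₁ κ₂ n))).FiniteIndex := by
    haveI := finiteIndex_imGS' (suppPF p 𝔣) (isOpen_pairLayerSubgroup κ₁ κ₂ (n + 1))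
    infer_instance
  letI : Fintype (↥(imGS (suppPF p 𝔣) (pairLayerSubgroup κ₁ κ₂ n)) ⧸
      (imGS (suppPF p 𝔣) (pairLayerSubgroup κ₁ κ₂ (n + 1))).subgroupOf (imGS (suppPF p 𝔣) (pairLayerSubgroup κ₁ κ₂ n))) :=
    Fintype.ofFinite _
  exact relCor_conjMap (imGS (suppPF p 𝔣) (pairLayerSubgroup κ₁ κ₂ n)) (imGS (suppPF p 𝔣) (pairLayerSubgroup κ₁ κ₂ (n + 1)))
    (coeffGS p (suppPF p 𝔣) θ k) (toUnramifiedQuot K (suppPF p 𝔣) γ)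
    (Subgroup.map_mono (pairLayerSubgroup_antitone κ₁ κ₂ (Nat.le_succ n))) i y

omit [NumberField K] in
/-- The reduction of coefficients commutes with the whole of `G_S` (not only the level group): `ζ ↦ ζ^p` is
`Γ_K`-equivariant (`muPowMap_muTwist`). [cite: Kato2004Asterisque, §8.2 (p. 180)] -/
theorem levelRedHom_equivariant (S : Set (HeightOneSpectrum (𝓞 K))) (U : Subgroup (absoluteGaloisGroup K)) (k : ℕ)
    (g : GaloisGroupUnramifiedOutside K S) (v : (levelRep p S θ U (k + 1)).toTopRep) :
    (levelRedHom p S θ U k).hom ((coeffGS p S θ (k + 1)).toTopRep.ρ g v) =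
      (coeffGS p S θ k).toTopRep.ρ g ((levelRedHom p S θ U k).hom v) := by
  obtain ⟨σ, rfl⟩ := QuotientGroup.mk_surjective g
  exact Subtype.ext (muPowMap_muTwist p θ k σ (v : MuCarrier K (p ^ (k + 1))))

omit [NumberField K] in
/-- **The reductions intertwine the conjugation operators** (`cohomologyMap_conjMap`).
[cite: Kato2004Asterisque, §8.2 (p. 180)] [cite: SerreLocalFields1979, VII §5] -/
theorem layerRed_layerConj (n k i : ℕ) (γ : absoluteGaloisGroup K) (y : layerCoh p κ₁ κ₂ θ 𝔣 n (k + 1) i) :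
    layerRed p κ₁ κ₂ θ 𝔣 n k i (layerConj p κ₁ κ₂ θ 𝔣 n (k + 1) i γ y) =
      layerConj p κ₁ κ₂ θ 𝔣 n k i γ (layerRed p κ₁ κ₂ θ 𝔣 n k i y) := by
  haveI := normal_imGS (suppPF p 𝔣) (pairLayerSubgroup κ₁ κ₂ n)
  have h := cohomologyMap_conjMap (X := (coeffGS p (suppPF p 𝔣) θ (k + 1)).toTopRep)
    (N := imGS (suppPF p 𝔣) (pairLayerSubgroup κ₁ κ₂ n)) (X' := (coeffGS p (suppPF p 𝔣) θ k).toTopRep)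
    (levelRedHom p (suppPF p 𝔣) θ (pairLayerSubgroup κ₁ κ₂ n) k) (levelRedHom p (suppPF p 𝔣) θ (pairLayerSubgroup κ₁ κ₂ n) k)
    (toUnramifiedQuot K (suppPF p 𝔣) γ) (fun v ↦
      ((congrArg ((coeffGS p (suppPF p 𝔣) θ k).toTopRep.ρ (toUnramifiedQuot K (suppPF p 𝔣) γ)⁻¹)
        (levelRedHom_equivariant p θ (suppPF p 𝔣) (pairLayerSubgroup κ₁ κ₂ n) k
          (toUnramifiedQuot K (suppPF p 𝔣) γ) v)).trans
        (ρ_inv_apply_ρ_apply (coeffGS p (suppPF p 𝔣) θ k).toTopRep _ _)).symm) i y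
  exact h

end LayerOps

end Literature.NumberTheory.ComplexMultiplication.EllipticUnits.JohnsonLeungKings2011

end
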